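import Summits.ValiantsHypothesis.ValiantsHypothesis.Theorems.KPlusLogSqLawTropicalBSeparable
import Summits.ValiantsHypothesis.ValiantsHypothesis.Theorems.LacunarySymmetroidMatrixDescartesLowRankSector

/-!
# Route `KPlusLogSqLaw`, crux `TropicalB` — the CLASS-RANK BUDGET: a separable full-support CLASS is used by at most ONE column of
# any dominant term; chains inject into the capped count vectors (tropical twin of the rank-capped Descartes ceiling)

HONEST FRAMING.  Helper toward the registered stubs of `Cruxes/TropicalB/Lines/birth.lean` (crux
`Summit.ValiantsHypothesis.ValiantsHypothesis.Theses.KPlusLogSqLaw.TropicalB`, item `stmt-ValiantsHypothesis-19771`); hand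
leafhand-val-kpluslogsqlaw-1 g5; companion of `…TropicalBSeparableSubsets` (all classes separable: `n + 1 ≤ C(K, m)`) and of the real-side
`…TowerGraftRankOnePencils` (`supp det ⊆` rank-admissible count vectors).  A located STRUCTURE law for designs in which SOME classes are
«tropically rank-one»; it bounds nothing for `TropicalB` on general designs and bears on neither `KPlusLogSqLaw`, `MatrixDescartes` nor `VP ≠ VNP`.

A class `l₀` is SEPARABLE if its valuations split as row plus column potentials, `v a b l₀ = r a + c b`, and FULL if every entry carries it
(`ε a b l₀ ≠ 0`) — the design of a rank-one real letter `t^{d_{l₀}} (x_a y_b)_{a,b}`.  The tree's swap argument (`…TropicalBSeparable`,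
val-sym-trop-p3, stated there for designs ALL of whose classes are separable) is local to one class:

* `not_swappable_of_dominant_separableAt` / `count_le_one_of_dominant_separableAt` — in a dominant term a separable full class is used
  by AT MOST ONE column (swapping the two columns gives a different present term of the same weight);
* `slope_eq_sum_count` — the slope of a term is `∑_l n_l · d_l` for its count vector `n`; `countVec_injective_of_chain` — along a
  dominant sign-alternating chain the count vectors are pairwise distinct (slopes strictly increase, tree `slope_lt_of_dominant`);
* **`succ_le_card_counts_of_separableOn`** — if every class of a set `R` is separable and full, a dominant sign-alternating chain of format
  `(m, K)` has `n + 1 ≤ #{n ∈ ℕ^K : ∑ n = m, n_l ≤ 1 (l ∈ R), n_l ≤ m (l ∉ R)}` — the tropical twin of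
  `RankOnePencils.card_posRoots_lt_card_counts` with `rank = 1` on `R`.  Reading for the tower-graft line: a far RANK-ONE graft letter
  (S4b/S4c) is ONE separable class `K`, used `0` or `1` times — the chain splits into the base block `n_K = 0` and the block `n_K = 1`
  (no `n_K = 2` block: the tropical side of «no `X^{2D}` digit»).

[folklore] Exchange argument; slope counting.
-/

set_option linter.dupNamespace false
set_option autoImplicit false

namespace Summit.ValiantsHypothesis.ValiantsHypothesis.Theorems.KPlusLogSqLaw.SeparableClassBudget

open Summit.ValiantsHypothesis.ValiantsHypothesis.Theorems.MatrixDescartes.Negative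
open Summit.ValiantsHypothesis.ValiantsHypothesis.Theorems.LacunarySymmetroidMatrixDescartes.TropicalCensus
open Summit.ValiantsHypothesis.ValiantsHypothesis.Theorems.LacunarySymmetroidMatrixDescartes.LowRankSector
  (sum_exp_eq_sum_count sum_count_eq)
open scoped BigOperators
open Finset

variable {m K : ℕ}

/-- A sum over `Fin m` split off at two distinct indices. [folklore] -/
theorem sum_eq_add_add_sum_erase_erase (g : Fin m → ℤ) {i i' : Fin m} (hne : i ≠ i') :
    ∑ j, g j = g i + (g i' + ∑ j ∈ ((Finset.univ : Finset (Fin m)).erase i).erase i', g j) := by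
  rw [Finset.add_sum_erase _ _ (Finset.mem_erase.mpr ⟨hne.symm, Finset.mem_univ i'⟩),
    Finset.add_sum_erase _ _ (Finset.mem_univ i)]

/-- **One separable full class is never used twice (swap form).**  If class `l₀` is separable (`v a b l₀ = r a + c b`), a dominant term
`(σ, μ)` cannot give two columns `i ≠ i'` the class `l₀` while the swapped entries `(σ i', i)`, `(σ i, i')` carry `l₀`. [folklore] -/
theorem not_swappable_of_dominant_separableAt (d : Fin K → ℕ) (v ε : Fin m → Fin m → Fin K → ℤ) (l₀ : Fin K)
    (r c : Fin m → ℤ) (hv : ∀ a b, v a b l₀ = r a + c b)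
    (θ : ℤ) (σ : Equiv.Perm (Fin m)) (μ : Fin m → Fin K) (hp : IsDominant d v ε θ (σ, μ))
    {i i' : Fin m} (hne : i ≠ i') (hi : μ i = l₀) (hi' : μ i' = l₀)
    (h1 : ε (σ i') i (μ i) ≠ 0) (h2 : ε (σ i) i' (μ i') ≠ 0) : False := by
  set τ : Equiv.Perm (Fin m) := Equiv.swap i i' with hτ
  have hqne : ((σ * τ : Equiv.Perm (Fin m)), μ) ≠ (σ, μ) := by
    intro h
    have h1' : σ * τ = σ := congrArg Prod.fst h
    have h2' : τ = 1 := by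
      have := congrArg (fun π => σ⁻¹ * π) h1'
      simpa [← mul_assoc] using this
    have : τ i = i := by rw [h2']; rfl
    rw [hτ, Equiv.swap_apply_left] at this
    exact hne this.symm
  -- the swapped term is present
  have hqpres : termSign ε ((σ * τ : Equiv.Perm (Fin m)), μ) ≠ 0 := by
    have hp0 := hp.1
    unfold termSign at hp0 ⊢
    have hprod : ∏ j, ε (σ j) j (μ j) ≠ 0 := (mul_ne_zero_iff.mp hp0).2
    rw [prod_ne_zero_iff] at hprod
    refine mul_ne_zero (by exact_mod_cast (Equiv.Perm.sign _).ne_zero) (prod_ne_zero_iff.mpr fun j _ => ?_)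
    simp only [Equiv.Perm.mul_apply]
    rcases eq_or_ne j i with rfl | hji
    · rw [hτ, Equiv.swap_apply_left]; exact h1
    · rcases eq_or_ne j i' with rfl | hji'
      · rw [hτ, Equiv.swap_apply_right]; exact h2
      · rw [hτ, Equiv.swap_apply_of_ne_of_ne hji hji']; exact hprod j (mem_univ _)
  have hlt := hp.2 _ hqne hqpres
  -- but the weights agree: only the two entries of class `l₀` move, and their valuations are separable
  have hw : tropWeight d v θ ((σ * τ : Equiv.Perm (Fin m)), μ) = tropWeight d v θ (σ, μ) := by
    show θ * ∑ j, (d (μ j) : ℤ) - ∑ j, v ((σ * τ) j) j (μ j) = θ * ∑ j, (d (μ j) : ℤ) - ∑ j, v (σ j) j (μ j)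
    congr 1
    simp only [Equiv.Perm.mul_apply]
    rw [sum_eq_add_add_sum_erase_erase (fun j => v (σ (τ j)) j (μ j)) hne,
      sum_eq_add_add_sum_erase_erase (fun j => v (σ j) j (μ j)) hne]
    have hrest : ∑ j ∈ ((Finset.univ : Finset (Fin m)).erase i).erase i', v (σ (τ j)) j (μ j) =
        ∑ j ∈ ((Finset.univ : Finset (Fin m)).erase i).erase i', v (σ j) j (μ j) := by
      refine Finset.sum_congr rfl fun j hj => ?_
      have hji' : j ≠ i' := (Finset.mem_erase.mp hj).1
      have hji : j ≠ i := (Finset.mem_erase.mp (Finset.mem_erase.mp hj).2).1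
      rw [hτ, Equiv.swap_apply_of_ne_of_ne hji hji']
    rw [hrest, hτ, Equiv.swap_apply_left, Equiv.swap_apply_right, hi, hi', hv, hv, hv, hv]
    ring
  rw [hw] at hlt
  exact lt_irrefl _ hlt

/-- **CLASS-RANK ONE.**  A separable FULL class `l₀` is used by at most one column of any dominant term. [folklore] -/
theorem count_le_one_of_dominant_separableAt (d : Fin K → ℕ) (v ε : Fin m → Fin m → Fin K → ℤ) (l₀ : Fin K)
    (r c : Fin m → ℤ) (hv : ∀ a b, v a b l₀ = r a + c b) (hε : ∀ a b, ε a b l₀ ≠ 0)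
    (θ : ℤ) (q : Equiv.Perm (Fin m) × (Fin m → Fin K)) (hp : IsDominant d v ε θ q) :
    ((Finset.univ : Finset (Fin m)).filter fun i => q.2 i = l₀).card ≤ 1 := by
  obtain ⟨σ, μ⟩ := q
  rw [Finset.card_le_one]
  intro i hi i' hi'
  by_contra hne
  have hμi : μ i = l₀ := (Finset.mem_filter.mp hi).2
  have hμi' : μ i' = l₀ := (Finset.mem_filter.mp hi').2
  exact not_swappable_of_dominant_separableAt d v ε l₀ r c hv θ σ μ hp hne hμi hμi'
    (by rw [hμi]; exact hε _ _) (by rw [hμi']; exact hε _ _)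

/-- The slope of a term is `∑_l n_l · d_l` for its class-count vector `n`. [folklore] -/
theorem slope_eq_sum_count (d : Fin K → ℕ) (q : Equiv.Perm (Fin m) × (Fin m → Fin K)) :
    LacunarySymmetroidMatrixDescartes.TropicalCensus.slope d q =
      ((∑ l, ((Finset.univ : Finset (Fin m)).filter fun i => q.2 i = l).card * d l : ℕ) : ℤ) := by
  unfold LacunarySymmetroidMatrixDescartes.TropicalCensus.slope
  rw [← sum_exp_eq_sum_count d q.2]
  push_cast
  rfl

/-- **Count vectors are injective along a dominant sign-alternating chain** (slopes strictly increase). [folklore] -/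
theorem countVec_injective_of_chain (d : Fin K → ℕ) (v ε : Fin m → Fin m → Fin K → ℤ)
    {n : ℕ} (θ : Fin (n + 1) → ℤ) (p : Fin (n + 1) → Equiv.Perm (Fin m) × (Fin m → Fin K))
    (hθ : StrictMono θ) (hdom : ∀ k, IsDominant d v ε (θ k) (p k))
    (halt : ∀ k : Fin n, termSign ε (p k.castSucc) * termSign ε (p k.succ) < 0) :
    Function.Injective fun k => fun l => ((Finset.univ : Finset (Fin m)).filter fun i => (p k).2 i = l).card := by
  have hne : ∀ k : Fin n, p k.castSucc ≠ p k.succ := by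
    intro k h
    have := halt k
    rw [h] at this
    exact absurd this (not_lt.mpr (mul_self_nonneg _))
  have hsm : StrictMono fun k => LacunarySymmetroidMatrixDescartes.TropicalCensus.slope d (p k) := by
    rw [Fin.strictMono_iff_lt_succ]
    intro k
    exact slope_lt_of_dominant d v ε (hθ (Fin.castSucc_lt_succ (i := k))) (hne k) (hdom _) (hdom _)
  intro k k' h
  apply hsm.injective
  simp only
  rw [slope_eq_sum_count, slope_eq_sum_count]
  have h' : ∀ l, ((Finset.univ : Finset (Fin m)).filter fun i => (p k).2 i = l).card =
      ((Finset.univ : Finset (Fin m)).filter fun i => (p k').2 i = l).card := fun l => congrFun h l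
  simp only [h']

/-- **THE CLASS-RANK BUDGET.**  If every class in `R` is separable and full, a dominant sign-alternating chain of format `(m, K)` has
`n + 1 ≤ #{n ∈ ℕ^K : ∑_l n_l = m, n_l ≤ 1 for l ∈ R, n_l ≤ m otherwise}`. [folklore] -/
theorem succ_le_card_counts_of_separableOn (d : Fin K → ℕ) (v ε : Fin m → Fin m → Fin K → ℤ)
    (R : Finset (Fin K)) (r c : Fin K → Fin m → ℤ) (hv : ∀ l ∈ R, ∀ a b, v a b l = r l a + c l b)
    (hε : ∀ l ∈ R, ∀ a b, ε a b l ≠ 0)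
    {n : ℕ} (θ : Fin (n + 1) → ℤ) (p : Fin (n + 1) → Equiv.Perm (Fin m) × (Fin m → Fin K))
    (hθ : StrictMono θ) (hdom : ∀ k, IsDominant d v ε (θ k) (p k))
    (halt : ∀ k : Fin n, termSign ε (p k.castSucc) * termSign ε (p k.succ) < 0) :
    n + 1 ≤ ((Fintype.piFinset fun l => Finset.range (if l ∈ R then 2 else m + 1)).filter
      (fun nv : Fin K → ℕ => ∑ l, nv l = m)).card := by
  have hinj := countVec_injective_of_chain d v ε θ p hθ hdom halt
  have hmem : ∀ k, (fun l => ((Finset.univ : Finset (Fin m)).filter fun i => (p k).2 i = l).card) ∈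
      (Fintype.piFinset fun l => Finset.range (if l ∈ R then 2 else m + 1)).filter
        (fun nv : Fin K → ℕ => ∑ l, nv l = m) := by
    intro k
    rw [Finset.mem_filter, Fintype.mem_piFinset]
    refine ⟨fun l => Finset.mem_range.mpr ?_, sum_count_eq (p k).2⟩
    split_ifs with hl
    · exact Nat.lt_succ_of_le
        (count_le_one_of_dominant_separableAt d v ε l (r l) (c l) (hv l hl) (hε l hl) (θ k) (p k) (hdom k))
    · exact Nat.lt_succ_of_le ((Finset.card_filter_le _ _).trans (by rw [Finset.card_univ, Fintype.card_fin]))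
  have hcard := Finset.card_le_card_of_injOn (s := (Finset.univ : Finset (Fin (n + 1))))
    (t := (Fintype.piFinset fun l => Finset.range (if l ∈ R then 2 else m + 1)).filter
      (fun nv : Fin K → ℕ => ∑ l, nv l = m))
    (fun k => fun l => ((Finset.univ : Finset (Fin m)).filter fun i => (p k).2 i = l).card)
    (fun k _ => hmem k) (fun k _ k' _ h => hinj h)
  rw [Finset.card_univ, Fintype.card_fin] at hcard
  exact hcard

end Summit.ValiantsHypothesis.ValiantsHypothesis.Theorems.KPlusLogSqLaw.SeparableClassBudget
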